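import Summits.CriticalPhenomena.PercolationContinuityZ3.Theorems.SahiMasterFamilyPointwisePrincipalCapSeven

/-!
# The pointwise pipeline at EVERY order: from `F(j+4)` and the pointwise principal cap (`j ≤ n`) to the whole (shared-)face-vanishing
# class of order `n+4` and its absorbing extensions of order `n+5`

Unit `prim-master-conj` (crux anchor stmt-CriticalPhenomena-4575, helper work), gen 14; memo
`run/shared/lean/prim/prim-l12/prim-master-conj/POINTWISE.md` §15.  After orders 6 (`…PointwisePrincipalCapSix`) and 7 (`…PointwisePrincipalCapSeven`) were
each written out by hand, this file packages the order-free part ONCE, with the two order-dependent inputs as hypotheses: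
* `hΦ : ∀ j ≤ n, PhiNonneg (j+4)` — P4's `F(j+4)` (kernel theorems for `j ≤ 3` at the time of writing: `PhiCert.phiNonneg_of_le_seven`);
* `hPC : ∀ j ≤ n, …` — the POINTWISE principal cap at order `j+4` (at interior `q`, a principal-cap `(j+4)`-family with `E = 0` is a zero flag;
  theorems for `j ≤ 3`: `principalCapPointwise_of_le_three`; for a new order it is `Pointwise.sahiE_ind_eq_zero_iff_of_principalCap_of_phiTransfer`
  applied to `PhiCert.phiTransfer_of_orbitPieces'` on P4's certificate data).
Conclusions at order `n+4` (all `p` for `C`, interior `p` for the zero locus): face-vanishing families (`pipeline_faceVanishing`: `C`, `E = 0 ↔ Z`, `E > 0`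
off `Z`; decreasing form; graph form), SHARED-face-vanishing families (`pipeline_sharedFaceVanishing`: `C` at EVERY `p` via the positivity-only induction,
zero locus and strict form at interior `p`; decreasing form), and ABSORBING extensions of shared-face-vanishing `(n+4)`-families = order `n+5`
(`pipeline_absorbing`).  So order `8` (and every later order) costs exactly: P4's `F(8)` data + `phiTransfer_eight` + a `j ≤ 4` case split.
HONEST FRAMING: conditional packaging; nothing is asserted about `F(k)`, `C_k` or `MasterFamilyEqIff k` in general.  Axioms standard. [this work]
-/

noncomputable section

open scoped Classical
open scoped unitInterval

namespace Summit.CriticalPhenomena.PercolationContinuityZ3.Theorems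

open Finset Function
open Literature.Combinatorics.Sahi2008
open Literature.Probability.LatticeModels (isUpperSet_preimage_compl)
open Literature.Probability.LatticeModels.Kahn2022 (Affects)
open Literature.Probability.Percolation (DeterminedBy determinedBy_iff)
open Literature.Probability.Percolation.DecisionTree (ind)
open SahiComb PrincipalCapBeta

namespace Pointwise

section Pipeline

variable {ι : Type} [Fintype ι] (n : ℕ)
  (hΦ : ∀ j, j ≤ n → PhiNonneg (j + 4))
  (hPC : ∀ j, j ≤ n → ∀ (κ : Type) [Fintype κ] (q : κ → unitInterval), (∀ e, (q e : ℝ) ∈ Set.Ioo (0 : ℝ) 1) →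
    ∀ (V : Fin (j + 4) → Set (Set κ)), (∀ i, IsUpperSet (V i)) →
    ∀ c : Finset κ, (∀ T : Set κ, (∀ i, T ∈ V i) ↔ (↑c : Set κ) ⊆ T) →
      sahiE (bernoulliWeight q) (j + 4) (fun i => ind (V i)) = 0 → SuppZeroFlag (j + 4) V)

include hΦ hPC

/-! ### 1. Face-vanishing families of order `n+4` -/

/-- **Pipeline, face-vanishing class**: `C_{n+4}` at every `p`, and at interior `p` the zero locus `E = 0 ↔ Z` and strict positivity off `Z`. [this work] -/
theorem pipeline_faceVanishing (p : ι → unitInterval) (U : Fin (n + 4) → Set (Set ι)) (S : Finset ι) (hU : ∀ j, IsUpperSet (U j))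
    (hUS : ∀ j, DeterminedBy (U j) (↑S : Set ι)) (hall : ∀ e ∈ S, ∀ b : Bool, SuppZeroFlag (n + 4) (fun j => secAt e b (U j))) :
    0 ≤ sahiE (bernoulliWeight p) (n + 4) (fun j => ind (U j)) ∧
      ((∀ e, (p e : ℝ) ∈ Set.Ioo (0 : ℝ) 1) →
        (sahiE (bernoulliWeight p) (n + 4) (fun j => ind (U j)) = 0 ↔ SuppZeroFlag (n + 4) U) ∧
        (¬ SuppZeroFlag (n + 4) U → 0 < sahiE (bernoulliWeight p) (n + 4) (fun j => ind (U j)))) := by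
  have h0 := sahiE_ind_nonneg_of_faceVanishing_of_phiNonneg n hΦ ι p U S hU hUS hall
  refine ⟨h0, fun hp => ?_⟩
  have hiff := sahiE_ind_eq_zero_iff_of_faceVanishing_of_principalCapPointwise n hPC ι p hp U S hU hUS hall
  exact ⟨hiff, fun hZ => lt_of_le_of_ne h0 fun h => hZ (hiff.1 h.symm)⟩

/-- **Pipeline, DECREASING face-vanishing families** (by complementation). [this work] -/
theorem pipeline_faceVanishing_lower (p : ι → unitInterval) (D : Fin (n + 4) → Set (Set ι)) (S : Finset ι) (hD : ∀ j, IsLowerSet (D j))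
    (hDS : ∀ j, DeterminedBy (D j) (↑S : Set ι)) (hall : ∀ e ∈ S, ∀ b : Bool, SuppZeroFlag (n + 4) (fun j => secAt e b (D j))) :
    0 ≤ sahiE (bernoulliWeight p) (n + 4) (fun j => ind (D j)) ∧
      ((∀ e, (p e : ℝ) ∈ Set.Ioo (0 : ℝ) 1) →
        (sahiE (bernoulliWeight p) (n + 4) (fun j => ind (D j)) = 0 ↔ SuppZeroFlag (n + 4) D)) := by
  rw [sahiE_ind_eq_sahiE_ind_preimage_compl, ← suppZeroFlag_preimage_compl_iff (n + 4) D]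
  have h := pipeline_faceVanishing n hΦ hPC (fun e => unitInterval.symm (p e)) (fun j => compl ⁻¹' D j) S
    (fun j => isUpperSet_preimage_compl (hD j))
    (fun j => (determinedBy_preimage_compl_iff (D j) _).2 (hDS j)) (faceVanishing_preimage_compl D S hall)
  exact ⟨h.1, fun hp => (h.2 ((symm_mem_Ioo_iff p).2 hp)).1⟩

/-! ### 2. Shared-face-vanishing families of order `n+4` -/

/-- **Pipeline, SHARED-face-vanishing class**: for `n+4` increasing events whose minors at every coordinate essential to at least two members are zero
flags: `C_{n+4}` at EVERY `p`; at interior `p`, `E = 0 ↔ Z` and `E > 0` off `Z`. [this work] -/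
theorem pipeline_sharedFaceVanishing (p : ι → unitInterval) (U : Fin (n + 4) → Set (Set ι)) (hU : ∀ j, IsUpperSet (U j))
    (hsh : ∀ e, (∃ i j, i ≠ j ∧ Affects (U i) e ∧ Affects (U j) e) → ∀ b : Bool, SuppZeroFlag (n + 4) (fun j => secAt e b (U j))) :
    0 ≤ sahiE (bernoulliWeight p) (n + 4) (fun j => ind (U j)) ∧
      ((∀ e, (p e : ℝ) ∈ Set.Ioo (0 : ℝ) 1) →
        (sahiE (bernoulliWeight p) (n + 4) (fun j => ind (U j)) = 0 ↔ SuppZeroFlag (n + 4) U) ∧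
        (¬ SuppZeroFlag (n + 4) U → 0 < sahiE (bernoulliWeight p) (n + 4) (fun j => ind (U j)))) := by
  have h0 : 0 ≤ sahiE (bernoulliWeight p) (n + 4) (fun j => ind (U j)) :=
    sahiE_ind_nonneg_of_shared_of_faceVanishing_all (n := n + 2) p
      (fun V S hV hVS hall => (pipeline_faceVanishing n hΦ hPC p V S hV hVS hall).1) _ U rfl hU hsh
  refine ⟨h0, fun hp => ?_⟩
  have h := sahiE_ind_nonneg_and_eq_zero_iff_of_shared_of_faceVanishing (n := n + 2) p hp
    (fun V S hV hVS hall => ⟨(pipeline_faceVanishing n hΦ hPC p V S hV hVS hall).1,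
      ((pipeline_faceVanishing n hΦ hPC p V S hV hVS hall).2 hp).1⟩) _ U rfl hU hsh
  exact ⟨h.2, fun hZ => lt_of_le_of_ne h0 fun h' => hZ (h.2.1 h'.symm)⟩

/-- **Pipeline, DECREASING shared-face-vanishing families** (dependence read through sections). [this work] -/
theorem pipeline_sharedFaceVanishing_lower (p : ι → unitInterval) (hp : ∀ e, (p e : ℝ) ∈ Set.Ioo (0 : ℝ) 1)
    (D : Fin (n + 4) → Set (Set ι)) (hD : ∀ j, IsLowerSet (D j))
    (hsh : ∀ e, (∃ i j, i ≠ j ∧ secAt e false (D i) ≠ secAt e true (D i) ∧ secAt e false (D j) ≠ secAt e true (D j)) →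
      ∀ b : Bool, SuppZeroFlag (n + 4) (fun j => secAt e b (D j))) :
    0 ≤ sahiE (bernoulliWeight p) (n + 4) (fun j => ind (D j)) ∧
      (sahiE (bernoulliWeight p) (n + 4) (fun j => ind (D j)) = 0 ↔ SuppZeroFlag (n + 4) D) := by
  rw [sahiE_ind_eq_sahiE_ind_preimage_compl, ← suppZeroFlag_preimage_compl_iff (n + 4) D]
  have hp' := (symm_mem_Ioo_iff p).2 hp
  have key := pipeline_sharedFaceVanishing n hΦ hPC (fun e => unitInterval.symm (p e)) (fun j => compl ⁻¹' D j)
    (fun j => isUpperSet_preimage_compl (hD j)) fun e ⟨i, j, hij, hi, hj⟩ b => by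
      have hi' := (secAt_ne_iff_preimage_compl e (D i)).2 ((affects_iff_secAt_ne (isUpperSet_preimage_compl (hD i)) e).1 hi)
      have hj' := (secAt_ne_iff_preimage_compl e (D j)).2 ((affects_iff_secAt_ne (isUpperSet_preimage_compl (hD j)) e).1 hj)
      have hZ := hsh e ⟨i, j, hij, hi', hj'⟩ (!b)
      have h := (suppZeroFlag_preimage_compl_iff (n + 4) (fun j => secAt e (!b) (D j))).2 hZ
      have hfam : (fun j => compl ⁻¹' secAt e (!b) (D j)) = fun j => secAt e b (compl ⁻¹' D j) := by
        funext j; rw [preimage_compl_secAt, Bool.not_not]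
      rwa [hfam] at h
  exact ⟨key.1, (key.2 hp').1⟩

/-! ### 3. Absorbing extensions: order `n+5` -/

/-- **Pipeline, absorbing extensions**: `n+5` increasing events one of which contains all the others, the other `n+4` shared-face-vanishing:
`C_{n+5}` at every `p`; at interior `p`, `E = 0 ↔ Z` and `E > 0` off `Z`. [this work] -/
theorem pipeline_absorbing (p : ι → unitInterval) (U : Fin (n + 5) → Set (Set ι)) (hU : ∀ i, IsUpperSet (U i)) (j : Fin (n + 5))
    (habs : ∀ l, l ≠ j → U l ⊆ U j)
    (hsh : ∀ e, (∃ i i', i ≠ i' ∧ Affects (U (j.succAbove i)) e ∧ Affects (U (j.succAbove i')) e) →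
      ∀ b : Bool, SuppZeroFlag (n + 4) (fun i => secAt e b (U (j.succAbove i)))) :
    0 ≤ sahiE (bernoulliWeight p) (n + 5) (fun i => ind (U i)) ∧
      ((∀ e, (p e : ℝ) ∈ Set.Ioo (0 : ℝ) 1) →
        (sahiE (bernoulliWeight p) (n + 5) (fun i => ind (U i)) = 0 ↔ SuppZeroFlag (n + 5) U) ∧
        (¬ SuppZeroFlag (n + 5) U → 0 < sahiE (bernoulliWeight p) (n + 5) (fun i => ind (U i)))) := by
  have hsub := pipeline_sharedFaceVanishing n hΦ hPC p (fun i => U (j.succAbove i)) (fun _ => hU _) hsh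
  have h0 : 0 ≤ sahiE (bernoulliWeight p) (n + 5) (fun i => ind (U i)) :=
    (sahiE_ind_nonneg_iff_erase_of_absorbing p (n := n + 2) U j habs).2 hsub.1
  refine ⟨h0, fun hp => ?_⟩
  have hiff : sahiE (bernoulliWeight p) (n + 5) (fun i => ind (U i)) = 0 ↔ SuppZeroFlag (n + 5) U :=
    (pointwise_iff_erase_of_absorbing p (n := n + 2) U hU j habs).2 (hsub.2 hp).1
  exact ⟨hiff, fun hZ => lt_of_le_of_ne h0 fun h => hZ (hiff.1 h.symm)⟩

end Pipeline

/-! ### 4. Graph form, every order -/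

section Graph

open Literature.Probability.Percolation

variable {V : Type} [Fintype V] (n : ℕ)
  (hΦ : ∀ j, j ≤ n → PhiNonneg (j + 4))
  (hPC : ∀ j, j ≤ n → ∀ (κ : Type) [Fintype κ] (q : κ → unitInterval), (∀ e, (q e : ℝ) ∈ Set.Ioo (0 : ℝ) 1) →
    ∀ (W : Fin (j + 4) → Set (Set κ)), (∀ i, IsUpperSet (W i)) →
    ∀ c : Finset κ, (∀ T : Set κ, (∀ i, T ∈ W i) ↔ (↑c : Set κ) ⊆ T) →
      sahiE (bernoulliWeight q) (j + 4) (fun i => ind (W i)) = 0 → SuppZeroFlag (j + 4) W)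

include hΦ hPC

/-- **Pipeline, graph form**: `n+4` group separations `{X_j ↮ Y_j}` whose single-edge minors at every edge on which at least two of them depend are
zero flags: at interior `w`, `E_{n+4} ≥ 0` and `E_{n+4} = 0 ↔` the tuple is a zero flag. [this work] -/
theorem pipeline_groupSep (w : Sym2 V → unitInterval) (hw : ∀ e, (w e : ℝ) ∈ Set.Ioo (0 : ℝ) 1) (X Y : Fin (n + 4) → Set V)
    (hsh : ∀ e : Sym2 V, (∃ i j, i ≠ j ∧
        secAt e false {ω : BondConfig V | ∀ x ∈ X i, ∀ y ∈ Y i, ¬ (openGraph ω).Reachable x y} ≠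
          secAt e true {ω : BondConfig V | ∀ x ∈ X i, ∀ y ∈ Y i, ¬ (openGraph ω).Reachable x y} ∧
        secAt e false {ω : BondConfig V | ∀ x ∈ X j, ∀ y ∈ Y j, ¬ (openGraph ω).Reachable x y} ≠
          secAt e true {ω : BondConfig V | ∀ x ∈ X j, ∀ y ∈ Y j, ¬ (openGraph ω).Reachable x y}) →
      ∀ b : Bool, SuppZeroFlag (n + 4) (fun j => secAt e b {ω : BondConfig V | ∀ x ∈ X j, ∀ y ∈ Y j, ¬ (openGraph ω).Reachable x y})) :
    0 ≤ sahiE (bernoulliWeight w) (n + 4) (fun j => ind {ω : BondConfig V | ∀ x ∈ X j, ∀ y ∈ Y j, ¬ (openGraph ω).Reachable x y}) ∧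
      (sahiE (bernoulliWeight w) (n + 4) (fun j => ind {ω : BondConfig V | ∀ x ∈ X j, ∀ y ∈ Y j, ¬ (openGraph ω).Reachable x y}) = 0 ↔
        SuppZeroFlag (n + 4) fun j => {ω : BondConfig V | ∀ x ∈ X j, ∀ y ∈ Y j, ¬ (openGraph ω).Reachable x y}) :=
  pipeline_sharedFaceVanishing_lower n hΦ hPC w hw _ (fun j => isLowerSet_groupSep (X j) (Y j)) hsh

end Graph

/-! ### 5. Sanity check: order seven recovered through the pipeline -/

/-- The inputs at `n = 3` (orders `4,…,7`) are theorems, so the pipeline reproduces `…PointwisePrincipalCapSeven` (statement check). [this work] -/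
theorem pipeline_sharedFaceVanishing_seven {ι : Type} [Fintype ι] (p : ι → unitInterval) (U : Fin 7 → Set (Set ι)) (hU : ∀ j, IsUpperSet (U j))
    (hsh : ∀ e, (∃ i j, i ≠ j ∧ Affects (U i) e ∧ Affects (U j) e) → ∀ b : Bool, SuppZeroFlag 7 (fun j => secAt e b (U j))) :
    0 ≤ sahiE (bernoulliWeight p) 7 (fun j => ind (U j)) ∧
      ((∀ e, (p e : ℝ) ∈ Set.Ioo (0 : ℝ) 1) →
        (sahiE (bernoulliWeight p) 7 (fun j => ind (U j)) = 0 ↔ SuppZeroFlag 7 U) ∧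
        (¬ SuppZeroFlag 7 U → 0 < sahiE (bernoulliWeight p) 7 (fun j => ind (U j)))) :=
  pipeline_sharedFaceVanishing 3 (fun j hj => PhiCert.phiNonneg_of_le_seven (by omega))
    (fun j hj κ _ q hq V hV c hpc hz => principalCapPointwise_of_le_three j hj κ q hq V hV c hpc hz) p U hU hsh

end Pointwise

end Summit.CriticalPhenomena.PercolationContinuityZ3.Theorems
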